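import Summits.FinalStateConjecture.FinalStateConjecture.Theses.PhotonSphereChannels
import Summits.FinalStateConjecture.FinalStateConjecture.Theorems.PhotonSphereChannelsExteriorEnergyRW
import Summits.FinalStateConjecture.FinalStateConjecture.Theorems.WindowedShellChannels.Negative.InfiniteEnergy
import Summits.FinalStateConjecture.FinalStateConjecture.Theorems.PhotonSphereChannelsWindowedShellChannelsStubUnitMass
import Summits.FinalStateConjecture.FinalStateConjecture.Theorems.PhotonSphereChannelsWindowedShellChannelsStubParity
import Summits.FinalStateConjecture.FinalStateConjecture.Theorems.PhotonSphereChannelsWindowedShellChannelsStubFiniteEnergy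
import Summits.FinalStateConjecture.FinalStateConjecture.Theorems.PhotonSphereChannelsWindowedShellChannelsStubRecentre
import Summits.FinalStateConjecture.FinalStateConjecture.Theorems.PhotonSphereChannelsChannelsResolveTameDevelopmentsRTotalEnergyConservation
import Summits.FinalStateConjecture.FinalStateConjecture.Theorems.PhotonSphereChannelsWindowedShellChannelsStubOutVirial
import Summits.FinalStateConjecture.FinalStateConjecture.Theorems.PhotonSphereChannelsWindowedShellChannelsStubDuality
import Summits.FinalStateConjecture.FinalStateConjecture.Theorems.PhotonSphereChannelsWindowedShellChannelsStubConeInflux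
import Summits.FinalStateConjecture.FinalStateConjecture.Theorems.PhotonSphereChannelsWindowedShellChannelsStubLostFlux
import Summits.FinalStateConjecture.FinalStateConjecture.Theorems.PhotonSphereChannelsWindowedShellChannelsStubPeakShape
import Summits.FinalStateConjecture.FinalStateConjecture.Theorems.PhotonSphereChannelsWindowedShellChannelsStubCompactRate
import Summits.FinalStateConjecture.FinalStateConjecture.Theorems.PhotonSphereChannelsWindowedShellChannelsStubLostPSD
import Summits.FinalStateConjecture.FinalStateConjecture.Theorems.PhotonSphereChannelsWindowedShellChannelsStubDyadicSplit
import Summits.FinalStateConjecture.FinalStateConjecture.Theorems.PhotonSphereChannelsWindowedShellChannelsStubNearFarAdditivity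
import Summits.FinalStateConjecture.FinalStateConjecture.Theorems.PhotonSphereChannelsWindowedShellChannelsStubNearHalfShare
import Summits.FinalStateConjecture.FinalStateConjecture.Theorems.PhotonSphereChannelsWindowedShellChannelsStubFarHalfShare
import Summits.FinalStateConjecture.FinalStateConjecture.Theorems.PhotonSphereChannelsWindowedShellChannelsStubFarPolyShare
import Summits.FinalStateConjecture.FinalStateConjecture.Theorems.PhotonSphereChannelsWindowedShellChannelsStubDropPSD
import Summits.FinalStateConjecture.FinalStateConjecture.Theorems.PhotonSphereChannelsWindowedShellChannelsStubLateDropInvSq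
import Summits.FinalStateConjecture.FinalStateConjecture.Theorems.PhotonSphereChannelsWindowedShellChannelsStubLateDropExp
import Summits.FinalStateConjecture.FinalStateConjecture.Theorems.PhotonSphereChannelsWindowedShellChannelsStubLayerSplit
import Summits.FinalStateConjecture.FinalStateConjecture.Theorems.PhotonSphereChannelsWindowedShellChannelsGlue

/-!
# v11 (lead c3): + stub_glue imported (…Glue); ONE sorry = stub_zonePoly (the kernel).
# v10 (lead c3): + stub_layerSplit p130639 imported; sorries left: stub_zonePoly (kernel), stub_glue (proved, chain landing: GlueCore p133866 → Glue).
# v9 (lead c3): = v8 with the four LANDED pieces imported (stub_farPolyShare p129254, stub_dropPSD p129648, stub_lateDropInvSq p129755,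
# stub_lateDropExp p129770); sorries left: stub_zonePoly (kernel), stub_layerSplit (worker), stub_glue (proved in work/Glue.lean, landing).
# v8 (lead c3, 2026-08-16): `stub_coreHigh σ` RE-LINED — it is now the COMPOSITION `stub_glue σ` of six registered pieces:
# `stub_zonePoly σ` (THE kernel: ℓ-uniform escape for data in a polynomial zone `[−(ℓ+2)^k, (ℓ+2)^k]` off the shell),
# `stub_farPolyShare` (explicit-threshold far share `A(ℓ+1)⁴`, from seat 0's flat-model comparison), `stub_layerSplit σ`
# (pigeonhole layer split with a data-poor gap), `stub_dropPSD` (one-sided windowed drop is PSD), `stub_lateDropInvSq` /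
# `stub_lateDropExp` (late-drop bounds for compactly supported data by characteristic transport; far side / reflected near
# side).  Everything below the v8 block is unchanged from v6/v7 (c2): per-mode residue closed, glue `core_of_split`, `core`,
# `WindowedShellChannels_of`.
#
# Crux `WindowedShellChannels` (stmt-FinalStateConjecture-14085) — line `Sketch` (ideator 1), lead skeleton v6 (IMPORT rendering — every piece landed)
# (lead seat prover-line-stmt-FinalStateConjecture-14085-c2-0, cycle 2; v1/v2 by lead c1; card `peak-cross-identity`)
#
# v4 = v2 + (i) `stub_outVirial` imported from its landed module (p103109 + p115527); (ii) the core stub `stub_trappedShare σ`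
# replaced by the two caught-form residues `stub_coreHigh σ` (semiclassical, ℓ ≥ ℓ₀(ρ)) and `stub_coreMode σ` (per mode) with
# PROVED glue `core_of_split`, the (★) bookkeeping of this line becoming the proved tools `caught_of_trappedShare`,
# `coreHigh_of_trappedShareHigh`, `coreMode_of_trappedShareMode` ((★)-form ⇒ caught-form, per regime).  FALLBACK rendering: `stub_coneInflux` (p112979), `stub_lostFlux` (p114417) and
# `stub_peakShape` (p115056) are LANDED but their modules are not yet built on the farm, so they stay here as sorried copies of
# their landed signatures; the import rendering is `work/WindowedShellChannels.lean` of this seat (identical otherwise).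

Composition (σ = time parity, `+1` even / `−1` odd; `V = V_{s,ℓ}` along the centred unit-mass tortoise line
`tortoiseRadius one_pos 0`, `x_p` = the peak of `V`):
```
W ⇐ stub_parity                 (LANDED p86825, imported)      W_even → W_odd → W
  ⇐ stub_finiteEnergy σ         (LANDED p87507, imported)      finite energy → general
  ⇐ stub_recentre σ             (LANDED p88529, imported)      xc = 0 → general (r, xc)
  ⇐ stub_unitMass σ             (LANDED p89324, imported)      M = 1 → general M
  ⇐ core σ := core_of …         (PROVED glue, this file)
  ⇐ stub_outVirial              (LANDED p103109 + part 2 p115527 pending; kept as a sorried copy until the module is farm-built)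
                                              virial law of the characteristic split OUT/IN:
                                              OUT(t₁) + ∫₀^{t₁}Vψ²(·,x_p) = OUT(0) + ∫₀^{t₁}(ψ_t²+ψ_x²)(·,x_p) + ½∫₀^{t₁}∫|V′|ψ²
  ⇐ stub_coneInflux             (LANDED p106592/p110559/p112979; sorried copy until farm-built)  kinetic influx through the null edges from (t₁,x_p) + exterior bulk ≤ IN(t₁)
  ⇐ stub_lostFlux               (LANDED p114417; sorried copy until farm-built)  E = caught(t₁) + kinetic influx + potential influx   (energy identity on the cone)
  ⇐ stub_peakShape              (LANDED p115056, K = 12, X = 3; sorried copy until farm-built)  V_{s,ℓ} (M = 1, centred) is C¹, single-peaked at some |x_p| ≤ X, |V′| ≤ K V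
  ⇐ core_of_split σ             (PROVED glue, v4)  one (h, c) per ρ for all modes (h = h_high + Σ_low h, 1/c = 1/c_high + Σ_low 1/c) from
  ⇐ stub_coreHigh σ             (OPEN — semiclassical residue, caught-form: ∃ℓ₀(ρ) ∃h c ∀ modes ℓ ≥ ℓ₀: c·E ≤ channelEnergy V 0 (ρ−h) ψ atTop)
  ⇐ stub_coreMode σ             (OPEN — per-mode residue, caught-form: ∀ (s,ℓ) ∃h c: the same)
TOOLS (proved, the line's content): caught_of_trappedShare / coreHigh_of_trappedShareHigh / coreMode_of_trappedShareMode —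
  the (★)-form (∃T c: some apex time t₁ ≤ T has P(t₁) + ∫₀^{t₁}Vψ²(·,x_p) ≤ (½−c)E + ∫₀^{t₁}(ψ_t²+ψ_x²)(·,x_p) + ½∫₀^{t₁}∫|V′|ψ² + B(t₁),
  the v1/v2 stub `stub_trappedShare σ` of lead c1, per regime) IMPLIES the corresponding caught-form residue.
```
`WindowedShellChannels_of` concludes the crux BY NAME; sorries only in `stub_*` (v2: the landed reductions are imported; the four
landed identity/shape stubs stay as sorried copies of their registered signatures until their modules are built on the farm).

The bookkeeping behind the glue (all terms in `[0,∞]`; `OUT(t) = ½∫_{x>x_p}[(ψ_t−ψ_x)²+Vψ²] + ½∫_{x<x_p}[(ψ_t+ψ_x)²+Vψ²]`,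
`IN = E − OUT`, `K/P` = kinetic/potential influx through the edges `x = x_p ± (t−t₁)`, `B = ½∬_{t>t₁,|x−x_p|>t−t₁}|V′|ψ²`):
`E = caught + K + P` (lostFlux), `K + B ≤ IN(t₁)` (coneInflux), `OUT + IN = E` (pointwise), parity-pure ⇒ `OUT(0) = IN(0)`,
so `caught + P ≥ OUT(t₁) + B`, and with the virial law
`caught(t₁) + P(t₁) + ∫₀^{t₁}Vψ²(·,x_p) ≥ E/2 + ∫₀^{t₁}(ψ_t²+ψ_x²)(·,x_p) + ½∫₀^{t₁}∫|V′|ψ² + B(t₁)`     (★)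
(numerically cross-checked to 3·10⁻³·E, `calc/peakcross_pure.py`, ℓ = 2, 6, 20, s = 1, 2, both parities).  With
`stub_trappedShare` this gives `caught(t₁) ≥ min(c,½)·E`, and `caught(t₁)` = the channel energy of aperture `−t₁` about `x_p`
is dominated by the channel energy of aperture `ρ − h` about `0` once `h ≥ ρ + T + X`.
-/

noncomputable section

set_option linter.dupNamespace false

namespace Summit.FinalStateConjecture.FinalStateConjecture.Theorems.WindowedShellChannelsSketch

open Literature.Geometry.Lorentzian Literature.Geometry.Lorentzian.ReggeWheeler
open Summit.FinalStateConjecture.FinalStateConjecture.Theses.PhotonSphereChannels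
open Summit.FinalStateConjecture.FinalStateConjecture.Theorems.WindowedShellChannelsStubs
open Filter Set MeasureTheory
open scoped ENNReal Topology



/-! ## The `Sketch` line proper: peak-cross bookkeeping for a general single-peaked potential -/

section Bookkeeping

end Bookkeeping

/-! ## The Regge–Wheeler instance (unit mass, centred tortoise line) -/

section ReggeWheeler

/-! ### v8 (lead c3): the ℓ-uniform residue `stub_coreHigh σ` as a line of six pieces + glue

Architecture (all pieces but the first are provable with the tree's 1+1 technology; see `Lines/Sketch.md` §v8):
`stub_coreHigh σ ⇐ stub_glue σ (stub_zonePoly σ) stub_farPolyShare (stub_layerSplit σ) stub_dropPSD stub_lateDropInvSq stub_lateDropExp`.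
The kernel `stub_zonePoly` is `stub_coreHigh` WEAKENED to compactly supported data inside a polynomial zone
`[−(ℓ+2)^k, (ℓ+2)^k]` (lag and constant chosen before `k`, threshold `ℓ₀` after); the other five pieces move the
far/near asymptotic regimes out of the kernel: an explicit-threshold far share (flat-model comparison, seat 0's
`stub_farHalfShare_compact` has `R_c = max 9 (4·(200(ℓ+1)²)²)`), a pigeonhole layer split with a data-poor gap layer,
weighted PSD-subadditivity of the one-sided windowed energy DROP, and two late-drop bounds for compactly supported data
(characteristic transport: inverse-square far side, exponentially small reflected near side).  Glue = time separation:
the far/near pieces reach the lagged cone edges only after the zone solution's remaining edge flux is `< εE`, so the PSD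
cross term costs `O(ε/η + η)E` instead of the `(1+η⁻¹)·LOST(zone)` that forbids lifting the per-mode glue. -/

/-- STUB — THE KERNEL (`stub_zonePoly σ`; ℓ-uniform finite-zone escape).  For every shell half-width `ρ > 0` there are
a lag `h ≥ 0` and `c > 0` such that for every polynomial degree `k` there is a threshold `ℓ₀` beyond which every
finite-energy parity-`σ` unit-mass centred Regge–Wheeler solution of a mode `s ≤ 2`, `s ≤ ℓ`, `ℓ₀ ≤ ℓ`, whose Cauchy
data vanish on the shell `{|x| ≤ ρ}` AND outside the zone `[−(ℓ+2)^k, (ℓ+2)^k]`, radiates at least `c·E` ahead of the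
lagged forward cone: `c·E ≤ channelEnergy V 0 (ρ − h) ψ atTop`.  (= `stub_coreHigh σ` restricted to compactly supported
data in a polynomial zone; its content is photon-sphere finite-time semiclassics plus the sub-barrier mid-far regime
`[√ℓ, ℓ ln ℓ]`; classical skeleton: every ray off the shell recedes from the photon sphere within lag `H⋆(ρ)` in one
time direction.) -/
theorem stub_zonePoly (σ : ℝ) : ∀ ρ : ℝ, 0 < ρ → ∃ h : ℝ, 0 ≤ h ∧ ∃ c : ℝ, 0 < c ∧ ∀ k : ℕ, ∃ ℓ₀ : ℕ,
    ∀ (s ℓ : ℕ), s ≤ 2 → s ≤ ℓ → ℓ₀ ≤ ℓ → ∀ ψ : ℝ → ℝ → ℝ,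
        IsRWSolution 1 s ℓ (tortoiseRadius one_pos 0) ψ → (∀ t x, ψ (-t) x = σ * ψ t x) →
        CauchyDataSupportedOn ψ ({x : ℝ | ρ < |x|} ∩ Icc (-(((ℓ : ℝ) + 2) ^ k)) (((ℓ : ℝ) + 2) ^ k)) →
        totalEnergy (linePotential 1 s ℓ (tortoiseRadius one_pos 0)) ψ 0 ≠ ⊤ →
          ENNReal.ofReal c * totalEnergy (linePotential 1 s ℓ (tortoiseRadius one_pos 0)) ψ 0 ≤
            channelEnergy (linePotential 1 s ℓ (tortoiseRadius one_pos 0)) 0 (ρ - h) ψ atTop := by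
  sorry

/-- THE SEMICLASSICAL CORE in caught-form (`stub_coreHigh σ`, v4–v7 the registered residue; v8: a COMPOSITION of the
six pieces above through `stub_glue`).  For every shell half-width `ρ > 0` there are a threshold `ℓ₀`, a lag `h ≥ 0`
and `c > 0` such that every finite-energy parity-`σ` Regge–Wheeler solution (unit mass, centred tortoise line) of a
mode `s ≤ 2`, `s ≤ ℓ`, `ℓ₀ ≤ ℓ` with Cauchy data vanishing on `{|x| ≤ ρ}` radiates at least `c·E` ahead of the lagged
forward cone, ℓ-UNIFORMLY above `ℓ₀(ρ)`. -/
theorem stub_coreHigh (σ : ℝ) : ∀ ρ : ℝ, 0 < ρ → ∃ ℓ₀ : ℕ, ∃ h : ℝ, 0 ≤ h ∧ ∃ c : ℝ, 0 < c ∧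
    ∀ (s ℓ : ℕ), s ≤ 2 → s ≤ ℓ → ℓ₀ ≤ ℓ → ∀ ψ : ℝ → ℝ → ℝ,
        IsRWSolution 1 s ℓ (tortoiseRadius one_pos 0) ψ → (∀ t x, ψ (-t) x = σ * ψ t x) →
        CauchyDataSupportedOn ψ {x : ℝ | ρ < |x|} →
        totalEnergy (linePotential 1 s ℓ (tortoiseRadius one_pos 0)) ψ 0 ≠ ⊤ →
          ENNReal.ofReal c * totalEnergy (linePotential 1 s ℓ (tortoiseRadius one_pos 0)) ψ 0 ≤
            channelEnergy (linePotential 1 s ℓ (tortoiseRadius one_pos 0)) 0 (ρ - h) ψ atTop :=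
  stub_glue σ (stub_zonePoly σ) stub_farPolyShare (stub_layerSplit σ) stub_dropPSD stub_lateDropInvSq
    stub_lateDropExp

/-! ### The per-mode residue as a line of five pieces (v5) -/

/-- COMPOSITION of the per-mode line (proved): the five pieces S1–S4, P2n, P2f give the per-mode residue `coreMode σ` (caught-form),
with lag `h = ρ + B` and constant `c₂/4`, `c₂ = min(c_near, c_far, 1)`: split `ψ = ψc + (ψn + ψf)` (S3, δ = c₂/4), lose at most
`(1+η⁻¹)·LOST(ψc) + (1+η)·LOST(ψn+ψf)` (S2, η = c₂/4), `LOST(ψc) ≤ (C₁R₁/B)·4E` (S1), `LOST(ψn+ψf) ≤ (1−c₂)(1+δ)E` (S4 + P2n + P2f +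
aperture monotonicity), and `B` so large that `4(1+η⁻¹)C₁R₁/B ≤ c₂/8`. -/
theorem coreMode (σ : ℝ) : ∀ ρ : ℝ, 0 < ρ → ∀ (s ℓ : ℕ), s ≤ 2 → s ≤ ℓ → ∃ h : ℝ, 0 ≤ h ∧ ∃ c : ℝ, 0 < c ∧
    ∀ ψ : ℝ → ℝ → ℝ,
        IsRWSolution 1 s ℓ (tortoiseRadius one_pos 0) ψ → (∀ t x, ψ (-t) x = σ * ψ t x) →
        CauchyDataSupportedOn ψ {x : ℝ | ρ < |x|} →
        totalEnergy (linePotential 1 s ℓ (tortoiseRadius one_pos 0)) ψ 0 ≠ ⊤ →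
          ENNReal.ofReal c * totalEnergy (linePotential 1 s ℓ (tortoiseRadius one_pos 0)) ψ 0 ≤
            channelEnergy (linePotential 1 s ℓ (tortoiseRadius one_pos 0)) 0 (ρ - h) ψ atTop := by
  intro ρ hρ s ℓ hs hsℓ
  classical
  -- the pieces of this mode
  obtain ⟨C₁, hC₁, HS1⟩ := stub_compactRate s ℓ hs hsℓ
  have HS2 := stub_lostPSD s ℓ hsℓ
  have HS4 := stub_nearFarAdditivity s ℓ hsℓ
  obtain ⟨cn, hcn, Rn, hRn, Bn, hBn, Hn⟩ := stub_nearHalfShare σ s ℓ hs hsℓ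
  obtain ⟨cf, hcf, Rf, hRf, Bf, hBf, Hf⟩ := stub_farHalfShare σ s ℓ hs hsℓ
  -- parameters
  set c₂ : ℝ := min (min cn cf) 1 with hc₂
  have hc₂0 : 0 < c₂ := lt_min (lt_min hcn hcf) one_pos
  have hc₂n : c₂ ≤ cn := (min_le_left _ _).trans (min_le_left _ _)
  have hc₂f : c₂ ≤ cf := (min_le_left _ _).trans (min_le_right _ _)
  have hc₂1 : c₂ ≤ 1 := min_le_right _ _
  set Bs : ℝ := max Bn Bf with hBs
  have hBs0 : 0 ≤ Bs := hBn.trans (le_max_left _ _)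
  have hBnBs : Bn ≤ Bs := le_max_left _ _
  have hBfBs : Bf ≤ Bs := le_max_right _ _
  set R₀ : ℝ := max (max Rn Rf) (max Bs (max ρ 1)) with hR₀
  have hRnR₀ : Rn ≤ R₀ := (le_max_left _ _).trans (le_max_left _ _)
  have hRfR₀ : Rf ≤ R₀ := (le_max_right _ _).trans (le_max_left _ _)
  have hBsR₀ : Bs ≤ R₀ := (le_max_left _ _).trans (le_max_right _ _)
  have hρR₀ : ρ ≤ R₀ := ((le_max_left _ _).trans (le_max_right _ _)).trans (le_max_right _ _)
  have h1R₀ : 1 ≤ R₀ := ((le_max_right _ _).trans (le_max_right _ _)).trans (le_max_right _ _)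
  set δ : ℝ := c₂ / 4 with hδ
  have hδ0 : 0 < δ := by positivity
  obtain ⟨R₁, hR₀R₁, HS3⟩ := stub_dyadicSplit σ s ℓ hsℓ ρ hρ δ hδ0 R₀ hρR₀
  have h1R₁ : 1 ≤ R₁ := h1R₀.trans hR₀R₁
  set η : ℝ := c₂ / 4 with hη
  have hη0 : 0 < η := by positivity
  set A : ℝ := 1 + η⁻¹ with hA
  have hA0 : 0 ≤ A := by positivity
  set X : ℝ := A * C₁ * R₁ with hX
  have hX0 : 0 ≤ X := by positivity
  set B : ℝ := max Bs (32 * X / c₂ + 1) with hB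
  have hB1 : 32 * X / c₂ + 1 ≤ B := le_max_right _ _
  have hB0 : 0 < B := lt_of_lt_of_le (by positivity) hB1
  have hBsB : Bs ≤ B := le_max_left _ _
  have hkey : A * (C₁ * R₁ / B) * 4 ≤ c₂ / 8 := by
    have h32 : 32 * X ≤ c₂ * B := by
      have h' : 32 * X / c₂ ≤ B := by linarith
      have h'' := (div_le_iff₀ hc₂0).1 h'
      linarith [mul_comm B c₂]
    rw [show A * (C₁ * R₁ / B) * 4 = 4 * X / B by rw [hX]; ring]
    rw [div_le_iff₀ hB0]
    linarith
  have hpoly : (1 + η) * (1 + δ) * (1 - c₂) ≤ 1 - c₂ / 2 := by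
    rw [hη, hδ]; nlinarith [sq_nonneg c₂, hc₂0.le, mul_nonneg (mul_nonneg hc₂0.le hc₂0.le) hc₂0.le]
  refine ⟨ρ + B, by positivity, c₂ / 4, by positivity, ?_⟩
  intro ψ hψ hpar hsupp hE
  obtain ⟨ψc, ψn, ψf, hψc, hψn, hψf, hsum, hpc, hpn, hpf, hsc, hsn, hsf, hEc, hEnf⟩ :=
    HS3 ψ hψ hpar hsupp hE
  have hr := isTortoiseRadius_tortoiseRadius one_pos (0 : ℝ)
  -- the outer sum and the full sum
  have hψnf : IsRWSolution 1 s ℓ (tortoiseRadius one_pos 0) (fun t x => ψn t x + ψf t x) :=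
    Duality.isSolution_add hψn hψf
  have hψeq : (fun t x => ψc t x + (ψn t x + ψf t x)) = ψ := by
    funext t x
    rw [hsum t x]
  -- instantiate the pieces BEFORE abstracting the potential
  have hsn' : CauchyDataSupportedOn ψn (Iio (-Rn)) := fun x hx =>
    hsn x (fun h => hx (mem_Iio.2 (lt_of_lt_of_le (mem_Iio.1 h) (by linarith))))
  have hsf' : CauchyDataSupportedOn ψf (Ioi Rf) := fun x hx =>
    hsf x (fun h => hx (mem_Ioi.2 (lt_of_le_of_lt hRfR₀ (mem_Ioi.1 h))))
  obtain ⟨K4a, K4b⟩ := HS4 R₀ Bs hBs0 hBsR₀ ψn ψf hψn hψf hsn hsf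
  have K2 := HS2 ψc (fun t x => ψn t x + ψf t x) hψc hψnf
  have K1 := HS1 R₁ h1R₁ ψc hψc hsc
  have Kn₀ := Hn ψn hψn hpn hsn'
  have Kf₀ := Hf ψf hψf hpf hsf'
  generalize hVdef : linePotential 1 s ℓ (tortoiseRadius one_pos 0) = V at *
  have hVd : Differentiable ℝ V := hVdef ▸ RW.differentiable_linePotential hr s ℓ
  have hV0 : ∀ x, 0 ≤ V x := fun x => hVdef ▸ (RW.linePotential_pos hr hsℓ x).le
  have hψ' : IsSolution V ψ := hVdef ▸ hψ
  have hψc' : IsSolution V ψc := hVdef ▸ hψc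
  have hψnf' : IsSolution V (fun t x => ψn t x + ψf t x) := hVdef ▸ hψnf
  -- channel energies never exceed the (conserved) energy
  have hcauE : ∀ (φ : ℝ → ℝ → ℝ), IsSolution V φ → ∀ a : ℝ,
      channelEnergy V 0 a φ atTop ≤ totalEnergy V φ 0 := by
    intro φ hφ a
    unfold channelEnergy
    calc liminf (exteriorEnergy V 0 a φ) atTop ≤ liminf (fun t => totalEnergy V φ t) atTop :=
          Filter.liminf_le_liminf (Eventually.of_forall fun t => exteriorEnergy_le_totalEnergy V 0 a φ t)
      _ = totalEnergy V φ 0 := by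
          simp_rw [RW.totalEnergy_eq_totalEnergy hVd hV0 hφ _ 0]
          exact Filter.liminf_const _
  -- names
  set E := totalEnergy V ψ 0 with hEdef
  set Ec := totalEnergy V ψc 0 with hEcdef
  set En := totalEnergy V ψn 0 with hEndef
  set Ef := totalEnergy V ψf 0 with hEfdef
  set k := channelEnergy V 0 (-B) ψ atTop with hkdef
  set kc := channelEnergy V 0 (-B) ψc atTop with hkcdef
  set knf := channelEnergy V 0 (-B) (fun t x => ψn t x + ψf t x) atTop with hknfdef
  -- finiteness
  have hEt : E ≠ ⊤ := hE
  have hEct : Ec ≠ ⊤ := ne_top_of_le_ne_top (ENNReal.mul_ne_top ENNReal.ofReal_ne_top hEt) hEc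
  have hEnft : En + Ef ≠ ⊤ := ne_top_of_le_ne_top (ENNReal.mul_ne_top ENNReal.ofReal_ne_top hEt) hEnf
  have hEnt : En ≠ ⊤ := ne_top_of_le_ne_top hEnft le_self_add
  have hEft : Ef ≠ ⊤ := ne_top_of_le_ne_top hEnft le_add_self
  have hkc_le : kc ≤ Ec := hcauE ψc hψc' (-B)
  have hknf_le : knf ≤ En + Ef := by
    have h := hcauE _ hψnf' (-B)
    rwa [K4b] at h
  have hk_le : k ≤ E := hcauE ψ hψ' (-B)
  have hkct : kc ≠ ⊤ := ne_top_of_le_ne_top hEct hkc_le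
  have hknft : knf ≠ ⊤ := ne_top_of_le_ne_top hEnft hknf_le
  have hkt : k ≠ ⊤ := ne_top_of_le_ne_top hEt hk_le
  -- (S2) at aperture `−B`, (S1) for the compact piece
  have hEnft' : totalEnergy V (fun t x => ψn t x + ψf t x) 0 ≠ ⊤ := by rw [K4b]; exact hEnft
  have K2' := K2 hEct hEnft' (-B) η hη0
  beta_reduce at K2'
  rw [hψeq, K4b] at K2'
  have K1' := K1 hEct B hB0
  -- the outer pieces: near and far half-shares, additivity, aperture monotonicity
  have Kn : ENNReal.ofReal c₂ * En ≤ channelEnergy V 0 (-Bs) ψn atTop := by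
    calc ENNReal.ofReal c₂ * En ≤ ENNReal.ofReal cn * En := mul_le_mul' (ENNReal.ofReal_le_ofReal hc₂n) le_rfl
      _ ≤ channelEnergy V 0 (-Bn) ψn atTop := Kn₀ hEnt
      _ ≤ channelEnergy V 0 (-Bs) ψn atTop := Parity.channelEnergy_mono_aperture V 0 (by linarith) ψn atTop
  have Kf : ENNReal.ofReal c₂ * Ef ≤ channelEnergy V 0 (-Bs) ψf atTop := by
    calc ENNReal.ofReal c₂ * Ef ≤ ENNReal.ofReal cf * Ef := mul_le_mul' (ENNReal.ofReal_le_ofReal hc₂f) le_rfl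
      _ ≤ channelEnergy V 0 (-Bf) ψf atTop := Kf₀ hEft
      _ ≤ channelEnergy V 0 (-Bs) ψf atTop := Parity.channelEnergy_mono_aperture V 0 (by linarith) ψf atTop
  have Knf : ENNReal.ofReal c₂ * (En + Ef) ≤ knf := by
    calc ENNReal.ofReal c₂ * (En + Ef) = ENNReal.ofReal c₂ * En + ENNReal.ofReal c₂ * Ef := mul_add _ _ _
      _ ≤ channelEnergy V 0 (-Bs) ψn atTop + channelEnergy V 0 (-Bs) ψf atTop := add_le_add Kn Kf
      _ ≤ channelEnergy V 0 (-Bs) (fun t x => ψn t x + ψf t x) atTop := K4a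
      _ ≤ knf := Parity.channelEnergy_mono_aperture V 0 (by linarith) _ atTop
  -- pass to real numbers
  have hA' : (0 : ℝ) ≤ 1 + η⁻¹ := hA0
  have hBq : (0 : ℝ) ≤ 1 + η := by positivity
  have t1 : ENNReal.ofReal (1 + η⁻¹) * kc ≠ ⊤ := ENNReal.mul_ne_top ENNReal.ofReal_ne_top hkct
  have t2 : ENNReal.ofReal (1 + η) * knf ≠ ⊤ := ENNReal.mul_ne_top ENNReal.ofReal_ne_top hknft
  have t3 : ENNReal.ofReal (1 + η⁻¹) * Ec ≠ ⊤ := ENNReal.mul_ne_top ENNReal.ofReal_ne_top hEct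
  have t4 : ENNReal.ofReal (1 + η) * (En + Ef) ≠ ⊤ := ENNReal.mul_ne_top ENNReal.ofReal_ne_top hEnft
  have t5 : ENNReal.ofReal (C₁ * R₁ / B) * Ec ≠ ⊤ := ENNReal.mul_ne_top ENNReal.ofReal_ne_top hEct
  have eK2 := ENNReal.toReal_mono (ENNReal.add_ne_top.2 ⟨ENNReal.add_ne_top.2 ⟨hkt, t3⟩, t4⟩) K2'
  rw [ENNReal.toReal_add (ENNReal.add_ne_top.2 ⟨hEt, t1⟩) t2, ENNReal.toReal_add hEt t1,
    ENNReal.toReal_add (ENNReal.add_ne_top.2 ⟨hkt, t3⟩) t4, ENNReal.toReal_add hkt t3,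
    ENNReal.toReal_mul, ENNReal.toReal_mul, ENNReal.toReal_mul, ENNReal.toReal_mul,
    ENNReal.toReal_ofReal hA', ENNReal.toReal_ofReal hBq] at eK2
  have eK1 := ENNReal.toReal_mono (ENNReal.add_ne_top.2 ⟨hkct, t5⟩) K1'
  rw [ENNReal.toReal_add hkct t5, ENNReal.toReal_mul,
    ENNReal.toReal_ofReal (by positivity : (0 : ℝ) ≤ C₁ * R₁ / B)] at eK1
  have eKnf := ENNReal.toReal_mono hknft Knf
  rw [ENNReal.toReal_mul, ENNReal.toReal_ofReal hc₂0.le] at eKnf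
  have eEc := ENNReal.toReal_mono (ENNReal.mul_ne_top ENNReal.ofReal_ne_top hEt) hEc
  rw [ENNReal.toReal_mul, ENNReal.toReal_ofReal (by norm_num : (0 : ℝ) ≤ 4)] at eEc
  have eEnf := ENNReal.toReal_mono (ENNReal.mul_ne_top ENNReal.ofReal_ne_top hEt) hEnf
  rw [ENNReal.toReal_mul, ENNReal.toReal_ofReal (by positivity : (0 : ℝ) ≤ 1 + δ)] at eEnf
  have e0 : 0 ≤ E.toReal := ENNReal.toReal_nonneg
  have ec0 : 0 ≤ Ec.toReal := ENNReal.toReal_nonneg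
  have enf0 : 0 ≤ (En + Ef).toReal := ENNReal.toReal_nonneg
  -- the two linear consequences
  have h₁ : (1 + η⁻¹) * (C₁ * R₁ / B) * Ec.toReal ≤ c₂ / 8 * E.toReal := by
    calc (1 + η⁻¹) * (C₁ * R₁ / B) * Ec.toReal ≤ (1 + η⁻¹) * (C₁ * R₁ / B) * (4 * E.toReal) :=
          mul_le_mul_of_nonneg_left eEc (by positivity)
      _ = A * (C₁ * R₁ / B) * 4 * E.toReal := by rw [hA]; ring
      _ ≤ c₂ / 8 * E.toReal := mul_le_mul_of_nonneg_right hkey e0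
  have h₂ : (1 + η) * ((1 - c₂) * (En + Ef).toReal) ≤ (1 - c₂ / 2) * E.toReal := by
    calc (1 + η) * ((1 - c₂) * (En + Ef).toReal) ≤ (1 + η) * ((1 - c₂) * ((1 + δ) * E.toReal)) :=
          mul_le_mul_of_nonneg_left (mul_le_mul_of_nonneg_left eEnf (by linarith)) hBq
      _ = (1 + η) * (1 + δ) * (1 - c₂) * E.toReal := by ring
      _ ≤ (1 - c₂ / 2) * E.toReal := mul_le_mul_of_nonneg_right hpoly e0
  have h₃ : (1 + η⁻¹) * Ec.toReal ≤ (1 + η⁻¹) * kc.toReal + (1 + η⁻¹) * (C₁ * R₁ / B) * Ec.toReal := by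
    have h := mul_le_mul_of_nonneg_left eK1 hA'
    have hid : (1 + η⁻¹) * (kc.toReal + C₁ * R₁ / B * Ec.toReal)
        = (1 + η⁻¹) * kc.toReal + (1 + η⁻¹) * (C₁ * R₁ / B) * Ec.toReal := by ring
    linarith [h, hid]
  have h₄ : (1 + η) * (En + Ef).toReal ≤ (1 + η) * knf.toReal + (1 + η) * ((1 - c₂) * (En + Ef).toReal) := by
    have h := mul_le_mul_of_nonneg_left eKnf hBq
    have hid : (1 + η) * (En + Ef).toReal
        = (1 + η) * ((1 - c₂) * (En + Ef).toReal) + (1 + η) * (c₂ * (En + Ef).toReal) := by ring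
    linarith [h, hid]
  have key' : E.toReal - c₂ / 8 * E.toReal - (1 - c₂ / 2) * E.toReal ≤ k.toReal := by
    linarith [eK2, h₁, h₂, h₃, h₄]
  have key : c₂ / 4 * E.toReal ≤ k.toReal := by
    have h5 : E.toReal - c₂ / 8 * E.toReal - (1 - c₂ / 2) * E.toReal = 3 / 8 * (c₂ * E.toReal) := by ring
    have h6 : c₂ / 4 * E.toReal = 1 / 4 * (c₂ * E.toReal) := by ring
    have h7 : 0 ≤ c₂ * E.toReal := mul_nonneg hc₂0.le e0
    rw [h6]
    linarith [key', h5, h7]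
  -- back to `ℝ≥0∞`, and the aperture `ρ − (ρ + B) = −B`
  have keyE : ENNReal.ofReal (c₂ / 4) * E ≤ k := by
    rw [← ENNReal.ofReal_toReal hEt, ← ENNReal.ofReal_mul (by positivity), ← ENNReal.ofReal_toReal hkt]
    exact ENNReal.ofReal_le_ofReal key
  rw [show ρ - (ρ + B) = -B by ring]
  exact keyE

/-- GLUE (proved): ONE `(h, c)` per `ρ` for ALL modes from the semiclassical stub above `ℓ₀(ρ)` and the per-mode stub on the
finitely many modes below it: `h = h_high + Σ_{s<3, ℓ<ℓ₀} h_{s,ℓ}`, `1/c = 1/c_high + Σ 1/c_{s,ℓ}` (the caught statement is monotone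
in `h ↑` by `Parity.channelEnergy_mono_aperture` and in `c ↓`). -/
theorem core_of_split (σ : ℝ) (Hh : ∀ ρ : ℝ, 0 < ρ → ∃ ℓ₀ : ℕ, ∃ h : ℝ, 0 ≤ h ∧ ∃ c : ℝ, 0 < c ∧
    ∀ (s ℓ : ℕ), s ≤ 2 → s ≤ ℓ → ℓ₀ ≤ ℓ → ∀ ψ : ℝ → ℝ → ℝ,
        IsRWSolution 1 s ℓ (tortoiseRadius one_pos 0) ψ → (∀ t x, ψ (-t) x = σ * ψ t x) →
        CauchyDataSupportedOn ψ {x : ℝ | ρ < |x|} →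
        totalEnergy (linePotential 1 s ℓ (tortoiseRadius one_pos 0)) ψ 0 ≠ ⊤ →
          ENNReal.ofReal c * totalEnergy (linePotential 1 s ℓ (tortoiseRadius one_pos 0)) ψ 0 ≤
            channelEnergy (linePotential 1 s ℓ (tortoiseRadius one_pos 0)) 0 (ρ - h) ψ atTop)
    (Hm : ∀ ρ : ℝ, 0 < ρ → ∀ (s ℓ : ℕ), s ≤ 2 → s ≤ ℓ → ∃ h : ℝ, 0 ≤ h ∧ ∃ c : ℝ, 0 < c ∧
    ∀ ψ : ℝ → ℝ → ℝ,
        IsRWSolution 1 s ℓ (tortoiseRadius one_pos 0) ψ → (∀ t x, ψ (-t) x = σ * ψ t x) →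
        CauchyDataSupportedOn ψ {x : ℝ | ρ < |x|} →
        totalEnergy (linePotential 1 s ℓ (tortoiseRadius one_pos 0)) ψ 0 ≠ ⊤ →
          ENNReal.ofReal c * totalEnergy (linePotential 1 s ℓ (tortoiseRadius one_pos 0)) ψ 0 ≤
            channelEnergy (linePotential 1 s ℓ (tortoiseRadius one_pos 0)) 0 (ρ - h) ψ atTop) :
    ∀ ρ : ℝ, 0 < ρ → ∃ h : ℝ, 0 ≤ h ∧ ∃ c : ℝ, 0 < c ∧
    ∀ (s ℓ : ℕ), s ≤ 2 → s ≤ ℓ → ∀ ψ : ℝ → ℝ → ℝ,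
        IsRWSolution 1 s ℓ (tortoiseRadius one_pos 0) ψ → (∀ t x, ψ (-t) x = σ * ψ t x) →
        CauchyDataSupportedOn ψ {x : ℝ | ρ < |x|} →
        totalEnergy (linePotential 1 s ℓ (tortoiseRadius one_pos 0)) ψ 0 ≠ ⊤ →
          ENNReal.ofReal c * totalEnergy (linePotential 1 s ℓ (tortoiseRadius one_pos 0)) ψ 0 ≤
            channelEnergy (linePotential 1 s ℓ (tortoiseRadius one_pos 0)) 0 (ρ - h) ψ atTop := by
  intro ρ hρ
  classical
  obtain ⟨ℓ₀, hh, hhh, ch, hch, Hh'⟩ := Hh ρ hρ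
  have Hm' := Hm ρ hρ
  -- choice functions on all pairs `(s, ℓ)` (dummy values off the admissible pairs)
  let hf : ℕ → ℕ → ℝ := fun s ℓ => if h : s ≤ 2 ∧ s ≤ ℓ then (Hm' s ℓ h.1 h.2).choose else 0
  let cf : ℕ → ℕ → ℝ := fun s ℓ =>
    if h : s ≤ 2 ∧ s ≤ ℓ then (Hm' s ℓ h.1 h.2).choose_spec.2.choose else 1
  have hhf : ∀ s ℓ, 0 ≤ hf s ℓ := by
    intro s ℓ
    by_cases h : s ≤ 2 ∧ s ≤ ℓ
    · simp only [hf, dif_pos h]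
      exact (Hm' s ℓ h.1 h.2).choose_spec.1
    · simp only [hf, dif_neg h, le_refl]
  have hcf : ∀ s ℓ, 0 < cf s ℓ := by
    intro s ℓ
    by_cases h : s ≤ 2 ∧ s ≤ ℓ
    · simp only [cf, dif_pos h]
      exact (Hm' s ℓ h.1 h.2).choose_spec.2.choose_spec.1
    · simp only [cf, dif_neg h, zero_lt_one]
  set hsum : ℝ := ∑ s' ∈ Finset.range 3, ∑ ℓ' ∈ Finset.range ℓ₀, hf s' ℓ' with hhsum
  set csum : ℝ := ∑ s' ∈ Finset.range 3, ∑ ℓ' ∈ Finset.range ℓ₀, (cf s' ℓ')⁻¹ with hcsum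
  have hhsum0 : 0 ≤ hsum :=
    Finset.sum_nonneg fun s' _ => Finset.sum_nonneg fun ℓ' _ => hhf s' ℓ'
  have hcsum0 : 0 ≤ csum :=
    Finset.sum_nonneg fun s' _ => Finset.sum_nonneg fun ℓ' _ => (inv_pos.2 (hcf s' ℓ')).le
  have hX : 0 < ch⁻¹ + csum := add_pos_of_pos_of_nonneg (inv_pos.2 hch) hcsum0
  refine ⟨hh + hsum, add_nonneg hhh hhsum0, (ch⁻¹ + csum)⁻¹, inv_pos.2 hX, ?_⟩
  intro s ℓ hs hsℓ ψ hψ hpar hsupp hE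
  by_cases hℓ : ℓ₀ ≤ ℓ
  · -- high modes
    have key := Hh' s ℓ hs hsℓ hℓ ψ hψ hpar hsupp hE
    have hc_le : (ch⁻¹ + csum)⁻¹ ≤ ch := by
      rw [inv_le_comm₀ hX hch]
      exact le_add_of_nonneg_right hcsum0
    calc ENNReal.ofReal (ch⁻¹ + csum)⁻¹ * totalEnergy (linePotential 1 s ℓ (tortoiseRadius one_pos 0)) ψ 0
        ≤ ENNReal.ofReal ch * totalEnergy (linePotential 1 s ℓ (tortoiseRadius one_pos 0)) ψ 0 :=
          mul_le_mul' (ENNReal.ofReal_le_ofReal hc_le) le_rfl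
      _ ≤ channelEnergy (linePotential 1 s ℓ (tortoiseRadius one_pos 0)) 0 (ρ - hh) ψ atTop := key
      _ ≤ channelEnergy (linePotential 1 s ℓ (tortoiseRadius one_pos 0)) 0 (ρ - (hh + hsum)) ψ atTop :=
          Parity.channelEnergy_mono_aperture _ 0 (by linarith) ψ atTop
  · -- low modes
    replace hℓ := not_le.1 hℓ
    have hval : s ≤ 2 ∧ s ≤ ℓ := ⟨hs, hsℓ⟩
    have hhf_eq : hf s ℓ = (Hm' s ℓ hs hsℓ).choose := by simp only [hf, dif_pos hval]
    have hcf_eq : cf s ℓ = (Hm' s ℓ hs hsℓ).choose_spec.2.choose := by simp only [cf, dif_pos hval]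
    have hspec := (Hm' s ℓ hs hsℓ).choose_spec.2.choose_spec
    have key := hspec.2 ψ hψ hpar hsupp hE
    have hs3 : s ∈ Finset.range 3 := Finset.mem_range.2 (by omega)
    have hℓr : ℓ ∈ Finset.range ℓ₀ := Finset.mem_range.2 hℓ
    have hh_le : (Hm' s ℓ hs hsℓ).choose ≤ hh + hsum := by
      rw [← hhf_eq]
      have h1' : hf s ℓ ≤ ∑ ℓ' ∈ Finset.range ℓ₀, hf s ℓ' :=
        Finset.single_le_sum (f := fun ℓ' => hf s ℓ') (fun ℓ' _ => hhf s ℓ') hℓr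
      have h2' : (∑ ℓ' ∈ Finset.range ℓ₀, hf s ℓ') ≤ hsum :=
        Finset.single_le_sum (f := fun s' => ∑ ℓ' ∈ Finset.range ℓ₀, hf s' ℓ')
          (fun s' _ => Finset.sum_nonneg fun ℓ' _ => hhf s' ℓ') hs3
      linarith
    have hc_le : (ch⁻¹ + csum)⁻¹ ≤ (Hm' s ℓ hs hsℓ).choose_spec.2.choose := by
      rw [← hcf_eq, inv_le_comm₀ hX (hcf s ℓ)]
      have h1' : (cf s ℓ)⁻¹ ≤ ∑ ℓ' ∈ Finset.range ℓ₀, (cf s ℓ')⁻¹ :=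
        Finset.single_le_sum (f := fun ℓ' => (cf s ℓ')⁻¹) (fun ℓ' _ => (inv_pos.2 (hcf s ℓ')).le) hℓr
      have h2' : (∑ ℓ' ∈ Finset.range ℓ₀, (cf s ℓ')⁻¹) ≤ csum :=
        Finset.single_le_sum (f := fun s' => ∑ ℓ' ∈ Finset.range ℓ₀, (cf s' ℓ')⁻¹)
          (fun s' _ => Finset.sum_nonneg fun ℓ' _ => (inv_pos.2 (hcf s' ℓ')).le) hs3
      have h3' : 0 < ch⁻¹ := inv_pos.2 hch
      linarith
    calc ENNReal.ofReal (ch⁻¹ + csum)⁻¹ * totalEnergy (linePotential 1 s ℓ (tortoiseRadius one_pos 0)) ψ 0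
        ≤ ENNReal.ofReal (Hm' s ℓ hs hsℓ).choose_spec.2.choose * totalEnergy (linePotential 1 s ℓ (tortoiseRadius one_pos 0)) ψ 0 :=
          mul_le_mul' (ENNReal.ofReal_le_ofReal hc_le) le_rfl
      _ ≤ channelEnergy (linePotential 1 s ℓ (tortoiseRadius one_pos 0)) 0 (ρ - (Hm' s ℓ hs hsℓ).choose) ψ atTop := key
      _ ≤ channelEnergy (linePotential 1 s ℓ (tortoiseRadius one_pos 0)) 0 (ρ - (hh + hsum)) ψ atTop :=
          Parity.channelEnergy_mono_aperture _ 0 (by linarith) ψ atTop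

end ReggeWheeler

/-! ## Glue (proved): (★) and the core -/

section Glue

variable {V : ℝ → ℝ} {ψ : ℝ → ℝ → ℝ}

/-- Continuity in `x` of the time derivative slice of a `C²` function. -/
theorem continuous_dt (hψ : ContDiff ℝ 2 (Function.uncurry ψ)) (t : ℝ) :
    Continuous fun x => deriv (fun τ => ψ τ x) t := by
  have hp : Continuous fun x : ℝ => ((t, x) : ℝ × ℝ) := continuous_const.prodMk continuous_id
  have h1 : Continuous fun x => fderiv ℝ (Function.uncurry ψ) (t, x) (1, 0) :=
    (WaveEnergy.continuous_fderiv_apply hψ (1, 0)).comp hp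
  refine h1.congr fun x => ?_
  rw [WaveEnergy.deriv_slice_fst_eq hψ]

/-- Continuity in `x` of the space derivative slice of a `C²` function. -/
theorem continuous_dx (hψ : ContDiff ℝ 2 (Function.uncurry ψ)) (t : ℝ) :
    Continuous fun x => deriv (ψ t) x := by
  have hp : Continuous fun x : ℝ => ((t, x) : ℝ × ℝ) := continuous_const.prodMk continuous_id
  have h1 : Continuous fun x => fderiv ℝ (Function.uncurry ψ) (t, x) (0, 1) :=
    (WaveEnergy.continuous_fderiv_apply hψ (0, 1)).comp hp
  refine h1.congr fun x => ?_
  rw [WaveEnergy.deriv_slice_snd_eq hψ]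

/-- Continuity in `x` of a time slice of a `C²` function. -/
theorem continuous_slice (hψ : ContDiff ℝ 2 (Function.uncurry ψ)) (t : ℝ) :
    Continuous fun x => ψ t x :=
  hψ.continuous.comp (continuous_const.prodMk continuous_id)

/-- `OUT(t) + IN(t) = E(t)`: the two characteristic energies at time `t` add up to the total energy. -/
theorem out_add_in (hV : Continuous V) (hV0 : ∀ x, 0 ≤ V x) (hψ : ContDiff ℝ 2 (Function.uncurry ψ))
    (xp t : ℝ) :
    ((∫⁻ x in Ioi xp, ENNReal.ofReal
        (2⁻¹ * ((deriv (fun τ => ψ τ x) t - deriv (ψ t) x) ^ 2 + V x * ψ t x ^ 2)))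
      + (∫⁻ x in Iio xp, ENNReal.ofReal
        (2⁻¹ * ((deriv (fun τ => ψ τ x) t + deriv (ψ t) x) ^ 2 + V x * ψ t x ^ 2))))
    + ((∫⁻ x in Ioi xp, ENNReal.ofReal
        (2⁻¹ * ((deriv (fun τ => ψ τ x) t + deriv (ψ t) x) ^ 2 + V x * ψ t x ^ 2)))
      + (∫⁻ x in Iio xp, ENNReal.ofReal
        (2⁻¹ * ((deriv (fun τ => ψ τ x) t - deriv (ψ t) x) ^ 2 + V x * ψ t x ^ 2))))
    = totalEnergy V ψ t := by
  have hac : Continuous fun x => deriv (fun τ => ψ τ x) t := continuous_dt hψ t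
  have hbc : Continuous fun x => deriv (ψ t) x := continuous_dx hψ t
  have hψc : Continuous fun x => ψ t x := continuous_slice hψ t
  have hm : Continuous fun x =>
      2⁻¹ * ((deriv (fun τ => ψ τ x) t - deriv (ψ t) x) ^ 2 + V x * ψ t x ^ 2) :=
    continuous_const.mul (((hac.sub hbc).pow 2).add (hV.mul (hψc.pow 2)))
  have hp : Continuous fun x =>
      2⁻¹ * ((deriv (fun τ => ψ τ x) t + deriv (ψ t) x) ^ 2 + V x * ψ t x ^ 2) :=
    continuous_const.mul (((hac.add hbc).pow 2).add (hV.mul (hψc.pow 2)))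
  have hmm : Measurable fun x => ENNReal.ofReal
      (2⁻¹ * ((deriv (fun τ => ψ τ x) t - deriv (ψ t) x) ^ 2 + V x * ψ t x ^ 2)) :=
    ENNReal.measurable_ofReal.comp hm.measurable
  have hpm : Measurable fun x => ENNReal.ofReal
      (2⁻¹ * ((deriv (fun τ => ψ τ x) t + deriv (ψ t) x) ^ 2 + V x * ψ t x ^ 2)) :=
    ENNReal.measurable_ofReal.comp hp.measurable
  -- pointwise: the two halves of the characteristic split add up to the energy density
  have hpt : ∀ x, ENNReal.ofReal
        (2⁻¹ * ((deriv (fun τ => ψ τ x) t - deriv (ψ t) x) ^ 2 + V x * ψ t x ^ 2))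
      + ENNReal.ofReal
        (2⁻¹ * ((deriv (fun τ => ψ τ x) t + deriv (ψ t) x) ^ 2 + V x * ψ t x ^ 2))
      = ENNReal.ofReal (energyDensity V ψ t x) := by
    intro x
    have hVx := hV0 x
    rw [← ENNReal.ofReal_add (by positivity) (by positivity)]
    congr 1
    simp only [energyDensity]
    ring
  have hR : (∫⁻ x in Ioi xp, ENNReal.ofReal
        (2⁻¹ * ((deriv (fun τ => ψ τ x) t - deriv (ψ t) x) ^ 2 + V x * ψ t x ^ 2)))
      + (∫⁻ x in Ioi xp, ENNReal.ofReal
        (2⁻¹ * ((deriv (fun τ => ψ τ x) t + deriv (ψ t) x) ^ 2 + V x * ψ t x ^ 2)))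
      = ∫⁻ x in Ioi xp, ENNReal.ofReal (energyDensity V ψ t x) := by
    rw [← lintegral_add_left hmm]
    exact lintegral_congr fun x => hpt x
  have hL : (∫⁻ x in Iio xp, ENNReal.ofReal
        (2⁻¹ * ((deriv (fun τ => ψ τ x) t + deriv (ψ t) x) ^ 2 + V x * ψ t x ^ 2)))
      + (∫⁻ x in Iio xp, ENNReal.ofReal
        (2⁻¹ * ((deriv (fun τ => ψ τ x) t - deriv (ψ t) x) ^ 2 + V x * ψ t x ^ 2)))
      = ∫⁻ x in Iio xp, ENNReal.ofReal (energyDensity V ψ t x) := by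
    rw [← lintegral_add_left hpm]
    exact lintegral_congr fun x => by rw [add_comm]; exact hpt x
  -- regroup: (R⁻ + L⁺) + (R⁺ + L⁻) = (R⁻ + R⁺) + (L⁺ + L⁻)
  have hregroup : ∀ p q r s : ℝ≥0∞, (p + q) + (r + s) = (p + r) + (q + s) := fun p q r s => by
    abel
  rw [hregroup, hR, hL]
  -- `Ioi xp ∪ Iio xp` is all of `ℝ` up to the null set `{xp}`
  unfold totalEnergy
  rw [← lintegral_union measurableSet_Iio (Set.disjoint_iff.2 fun x ⟨h1, h2⟩ =>
    (lt_irrefl x (lt_trans (mem_Iio.1 h2) (mem_Ioi.1 h1))).elim)]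
  have hset : Ioi xp ∪ Iio xp = ({xp}ᶜ : Set ℝ) := by
    ext x
    simp only [mem_union, mem_Ioi, mem_Iio, mem_compl_iff, mem_singleton_iff]
    constructor
    · rintro (h | h)
      · exact ne_of_gt h
      · exact ne_of_lt h
    · intro h
      rcases lt_or_gt_of_ne h with h | h
      · exact Or.inr h
      · exact Or.inl h
  rw [hset, setLIntegral_compl (measurableSet_singleton xp) (by simp),
    setLIntegral_measure_zero _ _ (measure_singleton xp), tsub_zero]

/-- Parity-pure data (`ψ(−t,x) = σψ(t,x)`) have `ψ_t(0,x)·ψ_x(0,x) = 0` (σ = 1 kills `ψ_t(0,·)`, σ ≠ 1 kills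
`ψ(0,·)` and hence `ψ_x(0,·)`). -/
theorem dt_mul_dx_zero {σ : ℝ} (hpar : ∀ t x, ψ (-t) x = σ * ψ t x) (x : ℝ) :
    deriv (fun τ => ψ τ x) 0 * deriv (ψ 0) x = 0 := by
  by_cases hσ : σ = 1
  · have h1 : deriv (fun τ => ψ (-τ) x) 0 = -deriv (fun τ => ψ τ x) 0 := by
      rw [deriv_comp_neg (fun τ => ψ τ x) 0, neg_zero]
    have h2 : (fun τ => ψ (-τ) x) = fun τ => ψ τ x :=
      funext fun τ => by rw [hpar, hσ, one_mul]
    rw [h2] at h1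
    have : deriv (fun τ => ψ τ x) 0 = 0 := by linarith
    rw [this, zero_mul]
  · have h0 : ∀ y, ψ 0 y = 0 := fun y => by
      have h := hpar 0 y
      rw [neg_zero] at h
      have h' : (1 - σ) * ψ 0 y = 0 := by linarith
      rcases mul_eq_zero.1 h' with h'' | h''
      · exact absurd (by linarith : σ = 1) hσ
      · exact h''
    have : deriv (ψ 0) x = 0 := by
      have hf : ψ 0 = fun _ => (0 : ℝ) := funext h0
      rw [hf, deriv_const]
    rw [this, mul_zero]

/-- Hence `OUT(0) = IN(0)` for parity-pure data: the characteristic split is balanced at `t = 0`. -/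
theorem out_eq_in_of_parity {σ : ℝ} (hpar : ∀ t x, ψ (-t) x = σ * ψ t x) (xp : ℝ) :
    (∫⁻ x in Ioi xp, ENNReal.ofReal
        (2⁻¹ * ((deriv (fun τ => ψ τ x) 0 - deriv (ψ 0) x) ^ 2 + V x * ψ 0 x ^ 2)))
      + (∫⁻ x in Iio xp, ENNReal.ofReal
        (2⁻¹ * ((deriv (fun τ => ψ τ x) 0 + deriv (ψ 0) x) ^ 2 + V x * ψ 0 x ^ 2)))
    = (∫⁻ x in Ioi xp, ENNReal.ofReal
        (2⁻¹ * ((deriv (fun τ => ψ τ x) 0 + deriv (ψ 0) x) ^ 2 + V x * ψ 0 x ^ 2)))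
      + (∫⁻ x in Iio xp, ENNReal.ofReal
        (2⁻¹ * ((deriv (fun τ => ψ τ x) 0 - deriv (ψ 0) x) ^ 2 + V x * ψ 0 x ^ 2))) := by
  have hpt : ∀ x, (deriv (fun τ => ψ τ x) 0 - deriv (ψ 0) x) ^ 2
      = (deriv (fun τ => ψ τ x) 0 + deriv (ψ 0) x) ^ 2 := fun x => by
    have h := dt_mul_dx_zero hpar x
    nlinarith [h]
  congr 1
  · exact lintegral_congr fun x => by rw [hpt x]
  · exact lintegral_congr fun x => by rw [hpt x]

/-- TOOL (proved; the content of line `Sketch`): **(★) + trapped share ⇒ caught**, one mode at a time.  For the potential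
`V = V_{s,ℓ}` (unit mass, centred line) with the shape data of `stub_peakShape` at the peak `xp`, if every finite-energy parity-`σ`
off-shell solution admits an apex time `t₁ ≤ T` with `P(t₁) + Q_V(t₁) ≤ (½ − c)E + Q₊(t₁) + C(t₁) + B(t₁)`, then every such solution
radiates at least `min(c, ½)·E` ahead of the forward cone of lag `h = ρ + T + X` about `0`.  Proof: the bookkeeping (★)
`caught(t₁) + P + Q_V ≥ E/2 + Q₊ + C + B` from `stub_outVirial` (virial law), `stub_coneInflux` (influx law), `stub_lostFlux`
(flux formula), `OUT + IN = E` and `OUT(0) = IN(0)` (parity), in `ℝ` after finiteness of every player, then the cone with apex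
`(t₁, xp)` sits inside the lagged cone about `0`. -/
theorem caught_of_trappedShare {σ ρ T c K X : ℝ} (hc : 0 < c) {s ℓ : ℕ} (hsℓ : s ≤ ℓ)
    (hHas : ∀ x, HasDerivAt (linePotential 1 s ℓ (tortoiseRadius one_pos 0))
      (deriv (linePotential 1 s ℓ (tortoiseRadius one_pos 0)) x) x)
    (hV'c : Continuous (deriv (linePotential 1 s ℓ (tortoiseRadius one_pos 0))))
    (hKV : ∀ x, |deriv (linePotential 1 s ℓ (tortoiseRadius one_pos 0)) x|
      ≤ K * linePotential 1 s ℓ (tortoiseRadius one_pos 0) x)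
    {xp : ℝ} (hxp : |xp| ≤ X) (hmono : ∀ x, (x - xp) * deriv (linePotential 1 s ℓ (tortoiseRadius one_pos 0)) x ≤ 0)
    (hTS : ∀ ψ : ℝ → ℝ → ℝ, IsRWSolution 1 s ℓ (tortoiseRadius one_pos 0) ψ → (∀ t x, ψ (-t) x = σ * ψ t x) →
        CauchyDataSupportedOn ψ {x : ℝ | ρ < |x|} →
        totalEnergy (linePotential 1 s ℓ (tortoiseRadius one_pos 0)) ψ 0 ≠ ⊤ →
        ∃ t₁ : ℝ, 0 ≤ t₁ ∧ t₁ ≤ T ∧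
          (∫⁻ t in Ioi t₁, ENNReal.ofReal
              (linePotential 1 s ℓ (tortoiseRadius one_pos 0) (xp + (t - t₁)) * ψ t (xp + (t - t₁)) ^ 2
                + linePotential 1 s ℓ (tortoiseRadius one_pos 0) (xp - (t - t₁)) * ψ t (xp - (t - t₁)) ^ 2))
            + ENNReal.ofReal (∫ τ in (0:ℝ)..t₁,
                linePotential 1 s ℓ (tortoiseRadius one_pos 0) xp * ψ τ xp ^ 2)
          ≤ ENNReal.ofReal ((2⁻¹ - c)
                * (totalEnergy (linePotential 1 s ℓ (tortoiseRadius one_pos 0)) ψ 0).toReal)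
            + ENNReal.ofReal (∫ τ in (0:ℝ)..t₁, (deriv (fun τ' => ψ τ' xp) τ ^ 2 + deriv (ψ τ) xp ^ 2))
            + (∫⁻ z in Ioo (0:ℝ) t₁ ×ˢ (univ : Set ℝ), ENNReal.ofReal
                (2⁻¹ * (|deriv (linePotential 1 s ℓ (tortoiseRadius one_pos 0)) z.2| * ψ z.1 z.2 ^ 2)))
            + (∫⁻ z in {z : ℝ × ℝ | t₁ < z.1 ∧ z.1 - t₁ < |z.2 - xp|}, ENNReal.ofReal
                (2⁻¹ * (|deriv (linePotential 1 s ℓ (tortoiseRadius one_pos 0)) z.2| * ψ z.1 z.2 ^ 2)))) :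
    ∀ ψ : ℝ → ℝ → ℝ,
        IsRWSolution 1 s ℓ (tortoiseRadius one_pos 0) ψ → (∀ t x, ψ (-t) x = σ * ψ t x) →
        CauchyDataSupportedOn ψ {x : ℝ | ρ < |x|} →
        totalEnergy (linePotential 1 s ℓ (tortoiseRadius one_pos 0)) ψ 0 ≠ ⊤ →
          ENNReal.ofReal (min c 2⁻¹) * totalEnergy (linePotential 1 s ℓ (tortoiseRadius one_pos 0)) ψ 0 ≤
            channelEnergy (linePotential 1 s ℓ (tortoiseRadius one_pos 0)) 0 (ρ - (ρ + T + X)) ψ atTop := by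
  intro ψ hψ hpar hsupp hE
  obtain ⟨t₁, ht₁0, ht₁T, hTS'⟩ := hTS ψ hψ hpar hsupp hE
  have hr := isTortoiseRadius_tortoiseRadius one_pos 0
  -- notation-free abbreviations
  generalize hVdef : linePotential 1 s ℓ (tortoiseRadius one_pos 0) = V at *
  have hVd : Differentiable ℝ V := hVdef ▸ RW.differentiable_linePotential hr s ℓ
  have hV0 : ∀ x, 0 ≤ V x := fun x => hVdef ▸ (RW.linePotential_pos hr hsℓ x).le
  have hψ' : IsSolution V ψ := hVdef ▸ hψ
  -- the three identities and the two structural facts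
  have hVir := stub_outVirial V (deriv V) K xp hHas hV'c hV0 hKV hmono ψ hψ' hE t₁ ht₁0
  have hInf := stub_coneInflux V (deriv V) K xp hHas hV'c hV0 hKV hmono ψ hψ' hE t₁
  have hFlux := stub_lostFlux V xp hVd hV0 ψ hψ' hE t₁ ht₁0
  have hsum₁ := out_add_in (V := V) hVd.continuous hV0 hψ'.1 xp t₁
  have hsum₀ := out_add_in (V := V) hVd.continuous hV0 hψ'.1 xp 0
  have hpar₀ := out_eq_in_of_parity (V := V) (ψ := ψ) hpar xp
  have hcons : totalEnergy V ψ t₁ = totalEnergy V ψ 0 :=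
    RW.totalEnergy_eq_totalEnergy hVd hV0 hψ' t₁ 0
  rw [hcons] at hsum₁
  -- name the players (closed terms, so `set` abstracts them in every hypothesis)
  set E := totalEnergy V ψ 0 with hEdef
  set caught := channelEnergy V xp (-t₁) ψ atTop with hcaught
  set Om₁ := ∫⁻ x in Ioi xp, ENNReal.ofReal
      (2⁻¹ * ((deriv (fun τ => ψ τ x) t₁ - deriv (ψ t₁) x) ^ 2 + V x * ψ t₁ x ^ 2)) with hOm₁
  set Lp₁ := ∫⁻ x in Iio xp, ENNReal.ofReal
      (2⁻¹ * ((deriv (fun τ => ψ τ x) t₁ + deriv (ψ t₁) x) ^ 2 + V x * ψ t₁ x ^ 2)) with hLp₁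
  set Op₁ := ∫⁻ x in Ioi xp, ENNReal.ofReal
      (2⁻¹ * ((deriv (fun τ => ψ τ x) t₁ + deriv (ψ t₁) x) ^ 2 + V x * ψ t₁ x ^ 2)) with hOp₁
  set Lm₁ := ∫⁻ x in Iio xp, ENNReal.ofReal
      (2⁻¹ * ((deriv (fun τ => ψ τ x) t₁ - deriv (ψ t₁) x) ^ 2 + V x * ψ t₁ x ^ 2)) with hLm₁
  set Om₀ := ∫⁻ x in Ioi xp, ENNReal.ofReal
      (2⁻¹ * ((deriv (fun τ => ψ τ x) 0 - deriv (ψ 0) x) ^ 2 + V x * ψ 0 x ^ 2)) with hOm₀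
  set Lp₀ := ∫⁻ x in Iio xp, ENNReal.ofReal
      (2⁻¹ * ((deriv (fun τ => ψ τ x) 0 + deriv (ψ 0) x) ^ 2 + V x * ψ 0 x ^ 2)) with hLp₀
  set Op₀ := ∫⁻ x in Ioi xp, ENNReal.ofReal
      (2⁻¹ * ((deriv (fun τ => ψ τ x) 0 + deriv (ψ 0) x) ^ 2 + V x * ψ 0 x ^ 2)) with hOp₀
  set Lm₀ := ∫⁻ x in Iio xp, ENNReal.ofReal
      (2⁻¹ * ((deriv (fun τ => ψ τ x) 0 - deriv (ψ 0) x) ^ 2 + V x * ψ 0 x ^ 2)) with hLm₀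
  set Kk := ∫⁻ t in Ioi t₁, ENNReal.ofReal
      ((deriv (fun τ => ψ τ (xp + (t - t₁))) t + deriv (ψ t) (xp + (t - t₁))) ^ 2
        + (deriv (fun τ => ψ τ (xp - (t - t₁))) t - deriv (ψ t) (xp - (t - t₁))) ^ 2) with hKk
  set Pp := ∫⁻ t in Ioi t₁, ENNReal.ofReal
      (V (xp + (t - t₁)) * ψ t (xp + (t - t₁)) ^ 2 + V (xp - (t - t₁)) * ψ t (xp - (t - t₁)) ^ 2)
    with hPp
  set Bb := ∫⁻ z in {z : ℝ × ℝ | t₁ < z.1 ∧ z.1 - t₁ < |z.2 - xp|},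
      ENNReal.ofReal (2⁻¹ * (|deriv V z.2| * ψ z.1 z.2 ^ 2)) with hBb
  set Cc := ∫⁻ z in Ioo (0:ℝ) t₁ ×ˢ (univ : Set ℝ),
      ENNReal.ofReal (2⁻¹ * (|deriv V z.2| * ψ z.1 z.2 ^ 2)) with hCc
  set QV := ENNReal.ofReal (∫ τ in (0:ℝ)..t₁, V xp * ψ τ xp ^ 2) with hQV
  set Qk := ENNReal.ofReal (∫ τ in (0:ℝ)..t₁,
      (deriv (fun τ' => ψ τ' xp) τ ^ 2 + deriv (ψ τ) xp ^ 2)) with hQk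
  -- the constant actually used
  set c' := min c 2⁻¹ with hc'
  have hc'c : c' ≤ c := min_le_left _ _
  have hc'h : c' ≤ 2⁻¹ := min_le_right _ _
  have hc'0 : 0 ≤ c' := (lt_min hc (by norm_num)).le
  have hTS'' : Pp + QV ≤ ENNReal.ofReal ((2⁻¹ - c') * E.toReal) + Qk + Cc + Bb := by
    refine hTS'.trans ?_
    have hmul : (2⁻¹ - c) * E.toReal ≤ (2⁻¹ - c') * E.toReal :=
      mul_le_mul_of_nonneg_right (by linarith) ENNReal.toReal_nonneg
    exact add_le_add (add_le_add (add_le_add (ENNReal.ofReal_le_ofReal hmul) le_rfl) le_rfl) le_rfl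
  -- finiteness of every player
  have hEt : E ≠ ⊤ := hE
  have hKt : Kk ≠ ⊤ := ne_top_of_le_ne_top hEt (by rw [← hFlux]; exact le_add_left le_rfl |>.trans (le_add_right le_rfl))
  have hPt : Pp ≠ ⊤ := ne_top_of_le_ne_top hEt (by rw [← hFlux]; exact le_add_left le_rfl)
  have hcat : caught ≠ ⊤ := ne_top_of_le_ne_top hEt (by rw [← hFlux, add_assoc]; exact le_add_right le_rfl)
  have hO₁t : Om₁ + Lp₁ ≠ ⊤ := ne_top_of_le_ne_top hEt (by rw [← hsum₁]; exact le_add_right le_rfl)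
  have hI₁t : Op₁ + Lm₁ ≠ ⊤ := ne_top_of_le_ne_top hEt (by rw [← hsum₁]; exact le_add_left le_rfl)
  have hO₀t : Om₀ + Lp₀ ≠ ⊤ := ne_top_of_le_ne_top hEt (by rw [← hsum₀]; exact le_add_right le_rfl)
  have hI₀t : Op₀ + Lm₀ ≠ ⊤ := ne_top_of_le_ne_top hEt (by rw [← hsum₀]; exact le_add_left le_rfl)
  have hBt : Bb ≠ ⊤ := ne_top_of_le_ne_top hI₁t (le_trans (le_add_left le_rfl) hInf)
  have hQVt : QV ≠ ⊤ := ENNReal.ofReal_ne_top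
  have hQkt : Qk ≠ ⊤ := ENNReal.ofReal_ne_top
  have hCt : Cc ≠ ⊤ := by
    refine ne_top_of_le_ne_top (ENNReal.add_ne_top.2 ⟨hO₁t, hQVt⟩) ?_
    rw [hVir]
    exact le_add_left le_rfl
  have hRt : ENNReal.ofReal ((2⁻¹ - c') * E.toReal) ≠ ⊤ := ENNReal.ofReal_ne_top
  -- pass to real numbers
  have eVir := congrArg ENNReal.toReal hVir
  rw [ENNReal.toReal_add hO₁t hQVt, ENNReal.toReal_add (ENNReal.add_ne_top.2 ⟨hO₀t, hQkt⟩) hCt,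
    ENNReal.toReal_add hO₀t hQkt] at eVir
  have eInf := ENNReal.toReal_mono hI₁t hInf
  rw [ENNReal.toReal_add hKt hBt] at eInf
  have eFlux := congrArg ENNReal.toReal hFlux
  rw [ENNReal.toReal_add (ENNReal.add_ne_top.2 ⟨hcat, hKt⟩) hPt, ENNReal.toReal_add hcat hKt] at eFlux
  have eSum₁ := congrArg ENNReal.toReal hsum₁
  rw [ENNReal.toReal_add hO₁t hI₁t] at eSum₁
  have eSum₀ := congrArg ENNReal.toReal hsum₀
  rw [ENNReal.toReal_add hO₀t hI₀t] at eSum₀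
  have ePar := congrArg ENNReal.toReal hpar₀
  have eTS := ENNReal.toReal_mono
    (ENNReal.add_ne_top.2 ⟨ENNReal.add_ne_top.2 ⟨ENNReal.add_ne_top.2 ⟨hRt, hQkt⟩, hCt⟩, hBt⟩) hTS''
  rw [ENNReal.toReal_add hPt hQVt, ENNReal.toReal_add (ENNReal.add_ne_top.2
      ⟨ENNReal.add_ne_top.2 ⟨hRt, hQkt⟩, hCt⟩) hBt,
    ENNReal.toReal_add (ENNReal.add_ne_top.2 ⟨hRt, hQkt⟩) hCt, ENNReal.toReal_add hRt hQkt,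
    ENNReal.toReal_ofReal (mul_nonneg (by linarith) ENNReal.toReal_nonneg)] at eTS
  -- (★) + trapped share ⇒ `c'·E ≤ caught`, in `ℝ`
  have key : c' * E.toReal ≤ caught.toReal := by nlinarith
  -- back to `ℝ≥0∞`
  have keyE : ENNReal.ofReal c' * E ≤ caught := by
    rw [← ENNReal.ofReal_toReal hEt, ← ENNReal.ofReal_mul hc'0, ← ENNReal.ofReal_toReal hcat]
    exact ENNReal.ofReal_le_ofReal key
  refine keyE.trans ?_
  -- the cone with apex `(t₁, xp)` sits inside the lagged cone of W (`h = ρ + T + X ≥ ρ + t₁ + |xp|`)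
  refine Filter.liminf_le_liminf (Eventually.of_forall fun t => ?_)
  unfold exteriorEnergy
  refine lintegral_mono_set fun x hx => ?_
  simp only [mem_setOf_eq, sub_zero] at hx ⊢
  have h1 : |x - xp| ≤ |x| + |xp| := abs_sub x xp
  linarith


/-- TOOL (proved): the (★)-form of the semiclassical core implies its caught-form `stub_coreHigh σ` (lag `ρ + T + X`, constant
`min(c, ½)`), by `caught_of_trappedShare` and `stub_peakShape`. -/
theorem coreHigh_of_trappedShareHigh (σ : ℝ)
    (H : ∀ ρ : ℝ, 0 < ρ → ∃ ℓ₀ : ℕ, ∃ T : ℝ, 0 ≤ T ∧ ∃ c : ℝ, 0 < c ∧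
    ∀ (s ℓ : ℕ), s ≤ 2 → s ≤ ℓ → ℓ₀ ≤ ℓ → ∀ xp : ℝ,
      (∀ x, (x - xp) * deriv (linePotential 1 s ℓ (tortoiseRadius one_pos 0)) x ≤ 0) →
      ∀ ψ : ℝ → ℝ → ℝ, IsRWSolution 1 s ℓ (tortoiseRadius one_pos 0) ψ → (∀ t x, ψ (-t) x = σ * ψ t x) →
        CauchyDataSupportedOn ψ {x : ℝ | ρ < |x|} →
        totalEnergy (linePotential 1 s ℓ (tortoiseRadius one_pos 0)) ψ 0 ≠ ⊤ →
        ∃ t₁ : ℝ, 0 ≤ t₁ ∧ t₁ ≤ T ∧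
          (∫⁻ t in Ioi t₁, ENNReal.ofReal
              (linePotential 1 s ℓ (tortoiseRadius one_pos 0) (xp + (t - t₁)) * ψ t (xp + (t - t₁)) ^ 2
                + linePotential 1 s ℓ (tortoiseRadius one_pos 0) (xp - (t - t₁)) * ψ t (xp - (t - t₁)) ^ 2))
            + ENNReal.ofReal (∫ τ in (0:ℝ)..t₁,
                linePotential 1 s ℓ (tortoiseRadius one_pos 0) xp * ψ τ xp ^ 2)
          ≤ ENNReal.ofReal ((2⁻¹ - c)
                * (totalEnergy (linePotential 1 s ℓ (tortoiseRadius one_pos 0)) ψ 0).toReal)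
            + ENNReal.ofReal (∫ τ in (0:ℝ)..t₁, (deriv (fun τ' => ψ τ' xp) τ ^ 2 + deriv (ψ τ) xp ^ 2))
            + (∫⁻ z in Ioo (0:ℝ) t₁ ×ˢ (univ : Set ℝ), ENNReal.ofReal
                (2⁻¹ * (|deriv (linePotential 1 s ℓ (tortoiseRadius one_pos 0)) z.2| * ψ z.1 z.2 ^ 2)))
            + (∫⁻ z in {z : ℝ × ℝ | t₁ < z.1 ∧ z.1 - t₁ < |z.2 - xp|}, ENNReal.ofReal
                (2⁻¹ * (|deriv (linePotential 1 s ℓ (tortoiseRadius one_pos 0)) z.2| * ψ z.1 z.2 ^ 2)))) :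
    ∀ ρ : ℝ, 0 < ρ → ∃ ℓ₀ : ℕ, ∃ h : ℝ, 0 ≤ h ∧ ∃ c : ℝ, 0 < c ∧
    ∀ (s ℓ : ℕ), s ≤ 2 → s ≤ ℓ → ℓ₀ ≤ ℓ → ∀ ψ : ℝ → ℝ → ℝ,
        IsRWSolution 1 s ℓ (tortoiseRadius one_pos 0) ψ → (∀ t x, ψ (-t) x = σ * ψ t x) →
        CauchyDataSupportedOn ψ {x : ℝ | ρ < |x|} →
        totalEnergy (linePotential 1 s ℓ (tortoiseRadius one_pos 0)) ψ 0 ≠ ⊤ →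
          ENNReal.ofReal c * totalEnergy (linePotential 1 s ℓ (tortoiseRadius one_pos 0)) ψ 0 ≤
            channelEnergy (linePotential 1 s ℓ (tortoiseRadius one_pos 0)) 0 (ρ - h) ψ atTop := by
  intro ρ hρ
  obtain ⟨K, -, X, hX0, hshape⟩ := stub_peakShape
  obtain ⟨ℓ₀, T, hT0, c, hc, hTS⟩ := H ρ hρ
  refine ⟨ℓ₀, ρ + T + X, by positivity, min c 2⁻¹, lt_min hc (by norm_num), fun s ℓ hs hsℓ hℓ => ?_⟩
  obtain ⟨hHas, hV'c, hKV, xp, hxp, hmono⟩ := hshape s ℓ hs hsℓ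
  exact caught_of_trappedShare hc hsℓ hHas hV'c hKV hxp hmono (hTS s ℓ hs hsℓ hℓ xp hmono)

/-- TOOL (proved): the (★)-form of the per-mode core implies its caught-form `stub_coreMode σ`. -/
theorem coreMode_of_trappedShareMode (σ : ℝ)
    (H : ∀ ρ : ℝ, 0 < ρ → ∀ (s ℓ : ℕ), s ≤ 2 → s ≤ ℓ →
    ∃ T : ℝ, 0 ≤ T ∧ ∃ c : ℝ, 0 < c ∧ ∀ xp : ℝ,
      (∀ x, (x - xp) * deriv (linePotential 1 s ℓ (tortoiseRadius one_pos 0)) x ≤ 0) →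
      ∀ ψ : ℝ → ℝ → ℝ, IsRWSolution 1 s ℓ (tortoiseRadius one_pos 0) ψ → (∀ t x, ψ (-t) x = σ * ψ t x) →
        CauchyDataSupportedOn ψ {x : ℝ | ρ < |x|} →
        totalEnergy (linePotential 1 s ℓ (tortoiseRadius one_pos 0)) ψ 0 ≠ ⊤ →
        ∃ t₁ : ℝ, 0 ≤ t₁ ∧ t₁ ≤ T ∧
          (∫⁻ t in Ioi t₁, ENNReal.ofReal
              (linePotential 1 s ℓ (tortoiseRadius one_pos 0) (xp + (t - t₁)) * ψ t (xp + (t - t₁)) ^ 2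
                + linePotential 1 s ℓ (tortoiseRadius one_pos 0) (xp - (t - t₁)) * ψ t (xp - (t - t₁)) ^ 2))
            + ENNReal.ofReal (∫ τ in (0:ℝ)..t₁,
                linePotential 1 s ℓ (tortoiseRadius one_pos 0) xp * ψ τ xp ^ 2)
          ≤ ENNReal.ofReal ((2⁻¹ - c)
                * (totalEnergy (linePotential 1 s ℓ (tortoiseRadius one_pos 0)) ψ 0).toReal)
            + ENNReal.ofReal (∫ τ in (0:ℝ)..t₁, (deriv (fun τ' => ψ τ' xp) τ ^ 2 + deriv (ψ τ) xp ^ 2))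
            + (∫⁻ z in Ioo (0:ℝ) t₁ ×ˢ (univ : Set ℝ), ENNReal.ofReal
                (2⁻¹ * (|deriv (linePotential 1 s ℓ (tortoiseRadius one_pos 0)) z.2| * ψ z.1 z.2 ^ 2)))
            + (∫⁻ z in {z : ℝ × ℝ | t₁ < z.1 ∧ z.1 - t₁ < |z.2 - xp|}, ENNReal.ofReal
                (2⁻¹ * (|deriv (linePotential 1 s ℓ (tortoiseRadius one_pos 0)) z.2| * ψ z.1 z.2 ^ 2)))) :
    ∀ ρ : ℝ, 0 < ρ → ∀ (s ℓ : ℕ), s ≤ 2 → s ≤ ℓ → ∃ h : ℝ, 0 ≤ h ∧ ∃ c : ℝ, 0 < c ∧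
    ∀ ψ : ℝ → ℝ → ℝ,
        IsRWSolution 1 s ℓ (tortoiseRadius one_pos 0) ψ → (∀ t x, ψ (-t) x = σ * ψ t x) →
        CauchyDataSupportedOn ψ {x : ℝ | ρ < |x|} →
        totalEnergy (linePotential 1 s ℓ (tortoiseRadius one_pos 0)) ψ 0 ≠ ⊤ →
          ENNReal.ofReal c * totalEnergy (linePotential 1 s ℓ (tortoiseRadius one_pos 0)) ψ 0 ≤
            channelEnergy (linePotential 1 s ℓ (tortoiseRadius one_pos 0)) 0 (ρ - h) ψ atTop := by
  intro ρ hρ s ℓ hs hsℓ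
  obtain ⟨K, -, X, hX0, hshape⟩ := stub_peakShape
  obtain ⟨T, hT0, c, hc, hTS⟩ := H ρ hρ s ℓ hs hsℓ
  obtain ⟨hHas, hV'c, hKV, xp, hxp, hmono⟩ := hshape s ℓ hs hsℓ
  exact ⟨ρ + T + X, by positivity, min c 2⁻¹, lt_min hc (by norm_num),
    caught_of_trappedShare hc hsℓ hHas hV'c hKV hxp hmono (hTS xp hmono)⟩

/-- The CORE of the line in the normal form of the landed reductions (parity `σ`, unit mass, centred tortoise line,
finite energy): the two registered residues glued by `core_of_split`. -/
theorem core (σ : ℝ) : ∀ ρ : ℝ, 0 < ρ → ∃ h : ℝ, 0 ≤ h ∧ ∃ c : ℝ, 0 < c ∧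
    ∀ (s ℓ : ℕ), s ≤ 2 → s ≤ ℓ → ∀ ψ : ℝ → ℝ → ℝ,
        IsRWSolution 1 s ℓ (tortoiseRadius one_pos 0) ψ → (∀ t x, ψ (-t) x = σ * ψ t x) →
        CauchyDataSupportedOn ψ {x : ℝ | ρ < |x|} →
        totalEnergy (linePotential 1 s ℓ (tortoiseRadius one_pos 0)) ψ 0 ≠ ⊤ →
          ENNReal.ofReal c * totalEnergy (linePotential 1 s ℓ (tortoiseRadius one_pos 0)) ψ 0 ≤
            channelEnergy (linePotential 1 s ℓ (tortoiseRadius one_pos 0)) 0 (ρ - h) ψ atTop :=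
  core_of_split σ (stub_coreHigh σ) (coreMode σ)

end Glue


/-! (Per-mode corollary `windowedShellChannels_perMode` = `Ideator3.FixedModeWindowedChannels`: proved here in v5b; being landed by
route seat 0 as Theorems/PhotonSphereChannelsWindowedShellChannelsPerMode.lean, p126938 — removed from the skeleton to avoid the name clash.) -/


/-! ## Composition: the crux by name -/

/-- **Line `Sketch` closes the crux modulo its stubs.**  `core (±1)` (glue of the five stubs) ⇒ unit mass ⇒
recentring ⇒ finite energy ⇒ parity regrading ⇒ `WindowedShellChannels`. -/
theorem WindowedShellChannels_of : WindowedShellChannels := by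
  have He := stub_finiteEnergy 1 (stub_recentre 1 (stub_unitMass 1 (core 1)))
  have Ho := stub_finiteEnergy (-1) (stub_recentre (-1) (stub_unitMass (-1) (core (-1))))
  refine stub_parity ?_ ?_
  · intro M hM ρ hρ
    obtain ⟨h, hh, c, hc, H⟩ := He M hM ρ hρ
    exact ⟨h, hh, c, hc, fun r xc hr s ℓ hs hsℓ ψ hψ hpar hsupp =>
      H r xc hr s ℓ hs hsℓ ψ hψ (fun t x => by rw [one_mul]; exact hpar t x) hsupp⟩
  · intro M hM ρ hρ
    obtain ⟨h, hh, c, hc, H⟩ := Ho M hM ρ hρ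
    exact ⟨h, hh, c, hc, fun r xc hr s ℓ hs hsℓ ψ hψ hpar hsupp =>
      H r xc hr s ℓ hs hsℓ ψ hψ (fun t x => by rw [neg_one_mul]; exact hpar t x) hsupp⟩

end Summit.FinalStateConjecture.FinalStateConjecture.Theorems.WindowedShellChannelsSketch

end
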